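/-
Origin: expansion seat `planner-pub-hodgecm-toy-0`, handover #2 2026-08-18T04:13:45Z (`HOME/pub-hodgecm-toy/lean/Toy/ExteriorHodge.lean`, md5 5c77a630, 154 lines);
landed by the gen-5 packager in gate run 21 as `HodgeCM/Model/Toy/ExteriorHodge.lean` (import ^import Toy\.→import HodgeCM.Model.Toy. ×2).
-/
-- HANDOVER (planner-pub-hodgecm-toy-0, unit pub-hodgecm-toy): WIP module `Toy.ExteriorHodge`; intended final module
-- `HodgeCM.Model.Toy.ExteriorHodge` (kind L5, toy model / consistency witness); rename `import Toy.X` ↦ the final prefix.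
/-
Copyright (c) 2026. All rights reserved.
Released under Apache 2.0 license as described in the file LICENSE.
-/
import Summits.HodgeConjecture.HodgeCM.Model.Toy.EigenBasis_2
import Summits.HodgeConjecture.HodgeCM.Model.Toy.Model

/-!
# The canonical Hodge data of the exterior model

`exteriorHodgeData : HodgeData` — for every object `X` and degree `k` the Hodge structure of weight `k`
on `⋀^k_ℚ L X` whose filtration is `F^p = Θ⁻¹ ⟨e_g : #hol(g) ≥ p⟩` (`HodgeCM.Toy.Obj.hodgeStructure`),
together with the three compatibilities the model needs:

* `natural` — a Hodge map of `H¹`-lattices induces filtered maps on all exterior powers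
  (filtration lemma `Obj.ιMulti_mem_FF` + `BC.theta_naturality`);
* `mul` — `F^p ⋀^k ∧ F^q ⋀^k ⊆ F^{p+q} ⋀^{2k}` (`BC.theta_wedge` + `Obj.coe_mono_mul`);
* `deg1` — in degree one it is the CM filtration `F¹ X` (`BC.theta_one_baseChange_oneEquiv_symm`).

With it, `toyModel := toyModelWith exteriorHodgeData` has honest induced Hodge structures on all its
cohomology groups (referee item G4: no axiom of `ModelAxioms` about Hodge types is discharged vacuously).
-/

noncomputable section

open TensorProduct exteriorPower Module

namespace HodgeCM.Toy

namespace Obj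

/-! ### Naturality -/

/-- (Ported verbatim from the HodgeCMPerL package; no docstring in the source.) -/
lemma map_mono {X Y : Obj} (φ : Y.LC →ₗ[ℂ] X.LC) (k : ℕ) (g : Fin k → Y.Idx) :
    exteriorPower.map k φ (Y.mono k g) = ιMulti ℂ k (fun j => φ (Y.eB (g j))) := by
  rw [mono, map_apply_ιMulti]
  rfl

/-- (Ported verbatim from the HodgeCMPerL package; no docstring in the source.) -/
lemma FF_map_le {X Y : Obj} (f : Hom X Y) (k : ℕ) (p : ℤ) :
    (Y.FF k p).map (exteriorPower.map k (f.lin.baseChange ℂ)) ≤ X.FF k p := by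
  rw [FF, Submodule.map_span_le]
  rintro _ ⟨g, hg, rfl⟩
  rw [map_mono]
  refine X.ιMulti_mem_FF _ p (Y.holSlots g) (fun j hj => ?_) hg
  rw [mem_holSlots] at hj
  rw [eB_apply']
  exact (isHodge_iff f.lin).mp f.hodge _ _ hj

/-- **Naturality** of the toy Hodge filtration. -/
theorem hodgeF_natural {X Y : Obj} (f : Hom X Y) (k : ℕ) (p : ℤ) :
    (Y.hodgeF k p).map ((exteriorPower.map k f.lin).baseChange ℂ) ≤ X.hodgeF k p := by
  rintro _ ⟨y, hy, rfl⟩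
  rw [SetLike.mem_coe, mem_hodgeF] at hy
  rw [mem_hodgeF, BC.thetaEquiv_apply, BC.theta_naturality]
  exact X.FF_map_le f k p ⟨_, hy, rfl⟩

/-! ### Multiplicativity -/

variable (X : Obj)

/-- (Ported verbatim from the HodgeCMPerL package; no docstring in the source.) -/
lemma wedge_mono (k l : ℕ) (g : Fin k → X.Idx) (g' : Fin l → X.Idx) :
    wedge ℂ X.LC k l (X.mono k g) (X.mono l g') = X.mono (k + l) (Fin.append g g') := by
  apply Subtype.ext
  rw [wedge_coe, coe_mono_mul]

/-- (Ported verbatim from the HodgeCMPerL package; no docstring in the source.) -/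
theorem wedge_mem_FF (k l : ℕ) (p q : ℤ) {a : ⋀[ℂ]^k X.LC} {b : ⋀[ℂ]^l X.LC}
    (ha : a ∈ X.FF k p) (hb : b ∈ X.FF l q) :
    wedge ℂ X.LC k l a b ∈ X.FF (k + l) (p + q) := by
  have h := Submodule.apply_mem_map₂ (wedge ℂ X.LC k l) ha hb
  rw [FF, FF, Submodule.map₂_span_span] at h
  refine (Submodule.span_le.mpr ?_) h
  rintro _ ⟨x, ⟨g, hg, rfl⟩, y, ⟨g', hg', rfl⟩, rfl⟩
  show wedge ℂ X.LC k l (X.mono k g) (X.mono l g') ∈ X.FF (k + l) (p + q)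
  rw [wedge_mono]
  exact X.mono_mem_FF (by rw [cnt_append]; push_cast; omega)

/-- **Multiplicativity** of the toy Hodge filtration. -/
theorem hodgeF_mul (k : ℕ) (p q : ℤ) (x y : ℂ ⊗[ℚ] ↥(⋀[ℚ]^k X.L))
    (hx : x ∈ X.hodgeF k p) (hy : y ∈ X.hodgeF k q) :
    LinearMap.BilinMap.baseChange ℂ (wedge ℚ X.L k k) x y ∈ X.hodgeF (k + k) (p + q) := by
  rw [mem_hodgeF] at hx hy ⊢
  have key : X.Θ (k + k) (LinearMap.BilinMap.baseChange ℂ (wedge ℚ X.L k k) x y)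
      = wedge ℂ X.LC k k (X.Θ k x) (X.Θ k y) := by
    apply Subtype.ext
    rw [wedge_coe]
    exact BC.theta_wedge ℚ ℂ X.L k x y
  rw [key]
  exact X.wedge_mem_FF k k p q hx hy

/-! ### Degree one -/

/-- (Ported verbatim from the HodgeCMPerL package; no docstring in the source.) -/
lemma one_le_cnt_iff (g : Fin 1 → X.Idx) : 1 ≤ (X.cnt g : ℤ) ↔ X.hol (g 0) := by
  constructor
  · intro h
    by_contra hn
    have : X.cnt g = 0 := by
      rw [cnt, Finset.card_eq_zero, Finset.eq_empty_iff_forall_notMem]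
      intro j hj
      rw [mem_holSlots, Subsingleton.elim j 0] at hj
      exact hn hj
    omega
  · intro h
    have h0 : (0 : Fin 1) ∈ X.holSlots g := by rw [mem_holSlots]; exact h
    have := Finset.card_pos.mpr ⟨0, h0⟩
    unfold cnt
    exact_mod_cast this

/-- (Ported verbatim from the HodgeCMPerL package; no docstring in the source.) -/
lemma FF_one_one : X.FF 1 1 = (X.F1).map (oneEquiv ℂ X.LC).symm.toLinearMap := by
  rw [F1_eq_span, Submodule.map_span, FF]
  congr 1
  ext x
  constructor
  · rintro ⟨g, hg, rfl⟩
    refine ⟨X.eB (g 0), ⟨g 0, (X.one_le_cnt_iff g).mp hg, rfl⟩, ?_⟩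
    rw [LinearEquiv.coe_coe, mono]
    have : (fun j => X.eB (g j)) = fun _ => X.eB (g 0) := by
      funext j; rw [Subsingleton.elim j 0]
    rw [this]
    simp [oneEquiv_symm_apply]
  · rintro ⟨_, ⟨s, hs, rfl⟩, rfl⟩
    refine ⟨fun _ => s, (X.one_le_cnt_iff _).mpr hs, ?_⟩
    rw [LinearEquiv.coe_coe, mono]
    simp [oneEquiv_symm_apply]

/-- **Degree one**: the toy filtration on `⋀¹ L X` is the CM filtration `F¹ X`. -/
theorem hodgeF_one (p : ℤ) : X.hodgeF 1 p = X.F1filt p := by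
  unfold Obj.F1filt
  split_ifs with h0 h1
  · exact X.hodgeF_eq_top h0
  · subst h1
    rw [hodgeF_eq_map, FF_one_one]
    have hmap : (oneEquiv ℚ X.L).symm.toLinearMap.baseChange ℂ
        = (X.Θ 1).symm.toLinearMap ∘ₗ (oneEquiv ℂ X.LC).symm.toLinearMap := by
      apply LinearMap.ext
      intro w
      rw [LinearMap.comp_apply, LinearEquiv.coe_coe, LinearEquiv.coe_coe, LinearEquiv.eq_symm_apply]
      exact BC.theta_one_baseChange_oneEquiv_symm ℚ ℂ X.L w
    rw [hmap, Submodule.map_comp]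
  · exact X.hodgeF_eq_bot (by push_cast; omega)

end Obj

/-- **The canonical Hodge data of the exterior model.** -/
def exteriorHodgeData : HodgeData where
  hs X k := X.hodgeStructure k
  natural f k p := Obj.hodgeF_natural f k p
  mul X k p q x y hx hy := X.hodgeF_mul k p q x y hx hy
  deg1 X p := X.hodgeF_one p

end HodgeCM.Toy

end
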